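import Mathlib

/-! # FermatTypes — every CM type of `ℚ(ζ_m)`, `m ∈ {15, 16, 20}`, is a Jacobi-sum (Fermat) type (seat p4 g3)

For `m ≥ 3` let `units m ⊂ ℕ` be the residues prime to `m` (`= (ℤ/m)^× = Gal(ℚ(ζ_m)/ℚ)`, complex conjugation `t ↦ m - t`).
A CM type is a subset `T` of the units containing exactly one of `t`, `m - t` for every unit `t`.  The Jacobi-sum type
`H m a b c = {t : ⟨ta/m⟩ + ⟨tb/m⟩ + ⟨tc/m⟩ = 1}` (`a + b + c ≡ 0 mod m`, `a, b, c ≢ 0`) is the CM type of the factor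
`J_{a,b,c}` of the Jacobian of the Fermat curve `x^m + y^m = 1` (Koblitz–Rohrlich 1978, Thm 1; for prime `m` as printed
in arXiv:1403.0807 Thm 2.3: `Jac(C_k) ∼ B_k^{|V_{k,1}|}` with CM type `H_{k,1}/V_{k,1}`, `H_{r,s} = {j : ⟨rj⟩ + ⟨sj⟩ < ℓ}`);
`translate m g T = T·g` is the Galois twist (same abelian variety, `ℚ(ζ_m)` acting through `g`).  The theorems say: for
`m = 15, 16, 20` EVERY CM type is a twist of a Jacobi-sum type, i.e. every CM abelian variety with CM by `ℚ(ζ_m)` (and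
hence every corner of every rank-four face of the Galois CM field `ℚ(ζ_m)`, Galois type `C4 × C2` with `c` a non-square) is
isogenous to a power of a simple factor of the Fermat Jacobian of degree `m`.  ROUTE.md §7 item 3 / §4 C3(b). -/

namespace HodgeRepro.P4.FermatTypes

/-- The units mod `m` as residues in `[1, m)` (a list in increasing order). -/
def units (m : ℕ) : List ℕ := (List.range m).filter fun t => Nat.gcd t m = 1

/-- `T` (a sublist of `units m`) is a CM type of `ℚ(ζ_m)`: it contains exactly one of `t`, `m - t` for every unit `t`. -/
def isCM (m : ℕ) (T : List ℕ) : Bool := (units m).all fun t => (decide (t ∈ T)) != (decide ((m - t) ∈ T))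

/-- The Jacobi-sum type `H_{a,b,c} = {t ∈ (ℤ/m)^× : ⟨ta/m⟩ + ⟨tb/m⟩ + ⟨tc/m⟩ = 1}`. -/
def H (m a b c : ℕ) : List ℕ := (units m).filter fun t => t * a % m + t * b % m + t * c % m = m

/-- The Galois twist `T ↦ T·g`. -/
def translate (m g : ℕ) (T : List ℕ) : List ℕ := T.map fun t => t * g % m

/-- `T` is (as a set) a twist of a Jacobi-sum type `H_{a,b,c}` with `a + b + c ≡ 0`, `a, b, c ≢ 0 (mod m)`. -/
def isFermatType (m : ℕ) (T : List ℕ) : Bool :=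
  (units m).any fun g => (List.range m).any fun a => (List.range m).any fun b =>
    decide (0 < a) && decide (0 < b) && decide ((a + b) % m ≠ 0) &&
      decide ((translate m g (H m a b ((2 * m - a - b) % m))).toFinset = T.toFinset)

/-- **`m = 15`**: every CM type of `ℚ(ζ₁₅)` (`(ℤ/15)^× ≅ C4 × C2`, `c = -1` a non-square) is a Jacobi-sum type. -/
theorem all_cm_types_fermat_15 : ∀ T ∈ (units 15).sublists, isCM 15 T = true → isFermatType 15 T = true := by
  decide +kernel

/-- **`m = 16`**: every CM type of `ℚ(ζ₁₆)` (`(ℤ/16)^× ≅ C4 × C2`, `c = -1` a non-square) is a Jacobi-sum type. -/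
theorem all_cm_types_fermat_16 : ∀ T ∈ (units 16).sublists, isCM 16 T = true → isFermatType 16 T = true := by
  decide +kernel

/-- **`m = 20`**: every CM type of `ℚ(ζ₂₀)` (`(ℤ/20)^× ≅ C4 × C2`, `c = -1` a non-square) is a Jacobi-sum type. -/
theorem all_cm_types_fermat_20 : ∀ T ∈ (units 20).sublists, isCM 20 T = true → isFermatType 20 T = true := by
  decide +kernel

/-- Sanity: `H_{8,8,14} = {2, 4, 8, 14}`, whose twist by `8` is `{1, 2, 4, 7}` — the primitive type of the simple CM fourfold
with CM by `ℚ(ζ₁₅)`. -/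
theorem example_15 : H 15 8 8 14 = [2, 4, 8, 14] ∧ (translate 15 8 (H 15 8 8 14)).toFinset = ({1, 2, 4, 7} : Finset ℕ) := by
  decide +kernel

/-- Sanity: there are exactly `16` CM types of `ℚ(ζ₁₅)`. -/
theorem card_cm_15 : ((units 15).sublists.filter fun T => isCM 15 T = true).length = 16 := by decide +kernel

/-- **`m = 13`** (`ℚ(ζ₁₃)`, `C12`): exactly `28` of the `64` CM types are Jacobi-sum types (3 of the 6 twist classes). -/
theorem count_fermat_13 : ((units 13).sublists.filter fun T => isCM 13 T && isFermatType 13 T).length = 28 := by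
  decide +kernel

/-- **`m = 21`** (`ℚ(ζ₂₁)`, `C6 × C2`): exactly `40` of the `64` CM types are Jacobi-sum types (6 of the 8 twist classes). -/
theorem count_fermat_21 : ((units 21).sublists.filter fun T => isCM 21 T && isFermatType 21 T).length = 40 := by
  decide +kernel

/-- Sanity: `ℚ(ζ₁₃)` and `ℚ(ζ₂₁)` have `64` CM types each. -/
theorem card_cm_13_21 : ((units 13).sublists.filter fun T => isCM 13 T = true).length = 64 ∧
    ((units 21).sublists.filter fun T => isCM 21 T = true).length = 64 := by
  decide +kernel

end HodgeRepro.P4.FermatTypes
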